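/-
Copyright (c) 2026 the pub-hodgecm-mathlib formalisation cell (harness21).  Prover seat hodgecm-mathlib-K2E5-p16 (g4): Track B «K2-LIT»,
hLiu418 = stmt-HodgeConjecture-24832, director req649 (S2) ∕ LEAD F0P6-plan (g11) deal of record 2026-09-04T05:23:13Z = organ Φ6a of ROAD Φ
(ruling «M-155l» §2; CENSUS-41 row Φ6, §3 «decisive»): DEFS leaf for `Theorems/K2LiuHermTwoGammaSiegelGindikin.lean`; 2026-09-04.
-/
import Mathlib.Analysis.SpecialFunctions.Gamma.Beta
import Mathlib.Analysis.SpecialFunctions.Gamma.Deriv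
import Mathlib.Analysis.Matrix.PosDef
import Mathlib.MeasureTheory.Constructions.BorelSpace.Complex
import HarnessLib

/-!
# Crux `HLiu418`, ROAD Φ (Fourier–Euler continuation of the Siegel Eisenstein series), organ Φ6a — DEFS leaf:
# the cone Gamma function `Γ₂(s) = π·Γ(s)·Γ(s−1)` of `Herm₂(ℂ)⁺` and the chart `ℝ × ℂ × ℝ ≃ Herm₂(ℂ)`

Cell `hodgecm-mathlib`, crux item hLiu418 = `stmt-HodgeConjecture-24832`, route of record `HCCMUnconditional`; squad K2, LEAD F0P6-plan (g11)
(deal req649 (S2), memo `F0/P6/F0P6-plan-g11/DEALS-req649-S1S2S3.v1.F0P6-plan-g11.md` §(S2)), dealer K2E5-plan (g5) (CENSUS-41), prover K2E5-p16 (g4).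
DEFINITIONS WITH BODIES + `rfl`∕algebraic API (no instance, no notation, no named-fact hypothesis, no `sorry`, default heartbeats); lane
`--supports stmt-HodgeConjecture-24832 --as helper` (count-neutral; definitions ⇒ review lane).  Mathlib-only, print-free.

THE OBJECTS.
* `hermTwoGamma s := π · Γ(s) · Γ(s − 1)` — the Gamma function of the self-dual homogeneous cone `Herm₂(ℂ)⁺` of positive definite `2 × 2`
  complex Hermitian matrices (Siegel–Gindikin; rank `r = 2`, Peirce constant `d = 2`, so `Γ_Ω(s) = π^{d·r(r−1)/4} ∏_{j<r} Γ(s − j·d/2)`), for the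
  Lebesgue measure `dx = da · d(Re z) · d(Im z) · db` on `x = [[a, z],[z̄, b]]`.  API: `hermTwoGamma_ne_zero`, `differentiableAt_hermTwoGamma`,
  `differentiableOn_hermTwoGamma` on the half-plane `1 < re s` (where the Siegel–Gindikin integral converges).
* `hermTwo (a, z, b) := !![a, z; z̄, b]` — the real-linear chart `ℝ × ℂ × ℝ → Matrix (Fin 2) (Fin 2) ℂ` onto the Hermitian matrices
  (`isHermitian_hermTwo`, `hermTwo_eq_of_isHermitian`), with `det_hermTwo : det = a·b − |z|²`, `trace_hermTwo_mul_hermTwo :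
  tr(x·y) = a·p + b·q + 2·Re(z·w̄)`, the `2 × 2` Sylvester criterion `posDef_hermTwo_iff : x > 0 ↔ 0 < a ∧ |z|² < a·b`, and the measurability of
  the cone `{c | (hermTwo c).PosDef}` in `ℝ × ℂ × ℝ` (product Lebesgue measure; `ℂ ≅ ℝ²` through its real inner-product structure, Mathlib's
  `volume` on `ℂ`).  This chart IS the carrier «`Herm₂(ℂ) ≅ ℝ⁴` via an explicit measurable equivalence» of the deal.

CONSUMER.  ★-to-be `Theorems/K2LiuHermTwoGammaSiegelGindikin.lean` (this seat): `∫_{x>0} e^{−tr(xy)} (det x)^{s−2} dx = Γ₂(s)·(det y)^{−s}`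
(`y > 0`, `1 < re s`, absolute convergence, holomorphy) — organ Φ6a; then Φ6b (Shimura's confluent hypergeometric functions `ξ, ω` on the
`Herm₂`-tube, [Shimura1982]) builds on both.
NOT here: any integral (sequel), the cone Gamma function for general rank, Bessel ∕ Whittaker functions.
HONEST LABEL.  Count-neutral DEFS leaf; it pays nothing by itself: `HC_CM` is proved only modulo the 7 printed citations (2 remaining named inputs:
hLiu418 = `stmt-HodgeConjecture-24832`, h413 = `stmt-HodgeConjecture-24833`) until rung 0 closes.

## References (orientation only; every statement below is proved from Mathlib)
* [Shimura1982] G. Shimura, *Confluent hypergeometric functions on tube domains*, Math. Ann. 260 (1982) 269–302: §1 (the Gamma function of the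
  cone and the gamma integral, Hermitian case «Case II»).
* J. Faraut, A. Korányi, *Analysis on Symmetric Cones* (Oxford 1994): Ch. VII §1 (`Γ_Ω`, Thm. VII.1.1).
-/

set_option autoImplicit false
-- the mandated namespace repeats the single-problem summit's segment (`HodgeConjecture.HodgeConjecture`)
set_option linter.dupNamespace false

noncomputable section

open Complex Matrix MeasureTheory
open scoped ComplexOrder ComplexConjugate

namespace Summit.HodgeConjecture.HodgeConjecture.Cruxes.HLiu418.K2LiuHermTwoGammaDefs

/-! ## The cone Gamma function `Γ₂` -/

/-- The Gamma function of the cone `Herm₂(ℂ)⁺` of positive definite `2 × 2` complex Hermitian matrices: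
`Γ₂(s) = π · Γ(s) · Γ(s − 1)` (Siegel–Gindikin, Hermitian case, rank 2; [Shimura1982, §1], Faraut–Korányi VII.1.1).  It is the value of
`∫_{x > 0} e^{−tr x} (det x)^{s−2} dx` for `1 < re s` (proved in the sequel file). -/
def hermTwoGamma (s : ℂ) : ℂ :=
  (Real.pi : ℂ) * Complex.Gamma s * Complex.Gamma (s - 1)

/-- Unfolding lemma for `hermTwoGamma`. -/
theorem hermTwoGamma_def (s : ℂ) :
    hermTwoGamma s = (Real.pi : ℂ) * Complex.Gamma s * Complex.Gamma (s - 1) := rfl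

/-- `Γ₂(s) ≠ 0` on the half-plane of convergence `1 < re s` (both Gamma factors have positive real part of the argument). -/
theorem hermTwoGamma_ne_zero {s : ℂ} (hs : 1 < s.re) : hermTwoGamma s ≠ 0 := by
  have h1 : Complex.Gamma s ≠ 0 := Complex.Gamma_ne_zero_of_re_pos (by linarith)
  have h2 : Complex.Gamma (s - 1) ≠ 0 :=
    Complex.Gamma_ne_zero_of_re_pos (by simp only [sub_re, one_re]; linarith)
  have hπ : (Real.pi : ℂ) ≠ 0 := ofReal_ne_zero.mpr Real.pi_pos.ne'
  exact mul_ne_zero (mul_ne_zero hπ h1) h2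

/-- `Γ₂` is complex-differentiable at every `s` with `1 < re s`. -/
theorem differentiableAt_hermTwoGamma {s : ℂ} (hs : 1 < s.re) : DifferentiableAt ℂ hermTwoGamma s := by
  have hpole : ∀ (t : ℂ), 0 < t.re → ∀ m : ℕ, t ≠ -(m : ℂ) := by
    intro t ht m h
    have h' := congrArg Complex.re h
    simp only [neg_re, natCast_re] at h'
    have hm : (0 : ℝ) ≤ (m : ℝ) := Nat.cast_nonneg m
    linarith
  have h1 : DifferentiableAt ℂ Complex.Gamma s := Complex.differentiableAt_Gamma s (hpole s (by linarith))
  have h2 : DifferentiableAt ℂ (fun t : ℂ => Complex.Gamma (t - 1)) s := by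
    have h2' : DifferentiableAt ℂ Complex.Gamma (s - 1) :=
      Complex.differentiableAt_Gamma _ (hpole _ (by simp only [sub_re, one_re]; linarith))
    exact h2'.comp s (differentiableAt_id.sub_const 1)
  have h3 : DifferentiableAt ℂ (fun t : ℂ => (Real.pi : ℂ) * Complex.Gamma t * Complex.Gamma (t - 1)) s :=
    ((differentiableAt_const _).mul h1).mul h2
  exact h3

/-- `Γ₂` is holomorphic on the open half-plane `{s | 1 < re s}`. -/
theorem differentiableOn_hermTwoGamma : DifferentiableOn ℂ hermTwoGamma {s : ℂ | 1 < s.re} :=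
  fun _ hs => (differentiableAt_hermTwoGamma hs).differentiableWithinAt

/-! ## The chart `ℝ × ℂ × ℝ → Herm₂(ℂ)` -/

/-- The Hermitian `2 × 2` complex matrix `[[a, z],[z̄, b]]` with real diagonal `a = c.1`, `b = c.2.2` and upper off-diagonal entry
`z = c.2.1`.  The map `c ↦ hermTwo c` is a real-linear bijection of `ℝ × ℂ × ℝ` onto the Hermitian matrices (`isHermitian_hermTwo`,
`hermTwo_eq_of_isHermitian`); the product Lebesgue measure on `ℝ × ℂ × ℝ` is the measure `dx` of the Siegel–Gindikin integral. -/
def hermTwo (c : ℝ × ℂ × ℝ) : Matrix (Fin 2) (Fin 2) ℂ :=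
  !![(c.1 : ℂ), c.2.1; conj c.2.1, (c.2.2 : ℂ)]

/-- Entry `(0,0)` of the chart: the real number `a`. -/
@[simp] theorem hermTwo_apply_zero_zero (c : ℝ × ℂ × ℝ) : hermTwo c 0 0 = (c.1 : ℂ) := rfl

/-- Entry `(0,1)` of the chart: `z`. -/
@[simp] theorem hermTwo_apply_zero_one (c : ℝ × ℂ × ℝ) : hermTwo c 0 1 = c.2.1 := rfl

/-- Entry `(1,0)` of the chart: `z̄`. -/
@[simp] theorem hermTwo_apply_one_zero (c : ℝ × ℂ × ℝ) : hermTwo c 1 0 = conj c.2.1 := rfl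

/-- Entry `(1,1)` of the chart: the real number `b`. -/
@[simp] theorem hermTwo_apply_one_one (c : ℝ × ℂ × ℝ) : hermTwo c 1 1 = (c.2.2 : ℂ) := rfl

/-- The chart lands in Hermitian matrices. -/
theorem isHermitian_hermTwo (c : ℝ × ℂ × ℝ) : (hermTwo c).IsHermitian := by
  refine Matrix.IsHermitian.ext fun i j => ?_
  fin_cases i <;> fin_cases j <;> simp [hermTwo]

/-- The chart is onto the Hermitian matrices: a Hermitian `y` is `hermTwo ((y 0 0).re, y 0 1, (y 1 1).re)`. -/
theorem hermTwo_eq_of_isHermitian {y : Matrix (Fin 2) (Fin 2) ℂ} (hy : y.IsHermitian) :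
    hermTwo ((y 0 0).re, y 0 1, (y 1 1).re) = y := by
  ext i j
  fin_cases i <;> fin_cases j
  · simpa [hermTwo] using hy.coe_re_apply_self 0
  · simp [hermTwo]
  · simpa [hermTwo] using hy.apply 1 0
  · simpa [hermTwo] using hy.coe_re_apply_self 1

/-- The chart is injective. -/
theorem hermTwo_injective : Function.Injective hermTwo := by
  rintro ⟨a, z, b⟩ ⟨a', z', b'⟩ h
  have h00 := congr_fun (congr_fun h 0) 0
  have h01 := congr_fun (congr_fun h 0) 1
  have h11 := congr_fun (congr_fun h 1) 1
  simp only [hermTwo_apply_zero_zero, hermTwo_apply_zero_one, hermTwo_apply_one_one, ofReal_inj] at h00 h01 h11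
  simp [h00, h01, h11]

/-- `det [[a, z],[z̄, b]] = a·b − |z|²` (a real number). -/
theorem det_hermTwo (c : ℝ × ℂ × ℝ) :
    (hermTwo c).det = ((c.1 * c.2.2 - Complex.normSq c.2.1 : ℝ) : ℂ) := by
  rw [hermTwo, Matrix.det_fin_two_of, Complex.mul_conj]
  push_cast
  ring

/-- `tr [[a, z],[z̄, b]] = a + b`. -/
theorem trace_hermTwo (c : ℝ × ℂ × ℝ) : (hermTwo c).trace = ((c.1 + c.2.2 : ℝ) : ℂ) := by
  rw [Matrix.trace_fin_two]
  simp

/-- `tr ([[a, z],[z̄, b]] · [[p, w],[w̄, q]]) = a·p + b·q + 2·Re(z·w̄)` (a real number). -/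
theorem trace_hermTwo_mul_hermTwo (c d : ℝ × ℂ × ℝ) :
    (hermTwo c * hermTwo d).trace = ((c.1 * d.1 + c.2.2 * d.2.2 + 2 * (c.2.1 * conj d.2.1).re : ℝ) : ℂ) := by
  rw [Matrix.trace_fin_two, Matrix.mul_apply, Matrix.mul_apply, Fin.sum_univ_two, Fin.sum_univ_two]
  apply Complex.ext <;> simp <;> ring

/-- `hermTwo c = 1` for `c = (1, 0, 1)`. -/
@[simp] theorem hermTwo_one_zero_one : hermTwo ((1 : ℝ), (0 : ℂ), (1 : ℝ)) = 1 := by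
  ext i j
  fin_cases i <;> fin_cases j <;> simp [hermTwo]

/-- The quadratic form of `[[a, z],[z̄, b]]` at `x = (u, v)`: `x* · hermTwo · x = a|u|² + b|v|² + 2·Re(ū·z·v)`. -/
theorem star_dotProduct_hermTwo_mulVec (c : ℝ × ℂ × ℝ) (x : Fin 2 → ℂ) :
    star x ⬝ᵥ (hermTwo c *ᵥ x) =
      ((c.1 * Complex.normSq (x 0) + c.2.2 * Complex.normSq (x 1) + 2 * (conj (x 0) * c.2.1 * x 1).re : ℝ) : ℂ) := by
  simp only [dotProduct, Matrix.mulVec, Fin.sum_univ_two, Pi.star_apply, hermTwo_apply_zero_zero, hermTwo_apply_zero_one,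
    hermTwo_apply_one_zero, hermTwo_apply_one_one]
  apply Complex.ext
  · simp [Complex.normSq_apply]
    ring
  · simp [Complex.normSq_apply]
    ring

/-- SYLVESTER'S CRITERION for `2 × 2` Hermitian matrices: `[[a, z],[z̄, b]]` is positive definite iff `0 < a` and `|z|² < a·b`. -/
theorem posDef_hermTwo_iff (c : ℝ × ℂ × ℝ) :
    (hermTwo c).PosDef ↔ 0 < c.1 ∧ Complex.normSq c.2.1 < c.1 * c.2.2 := by
  constructor
  · intro h
    have h00 := h.dotProduct_mulVec_pos (x := Pi.single 0 1) (by
      intro h0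
      have := congr_fun h0 0
      simp at this)
    rw [star_dotProduct_hermTwo_mulVec] at h00
    simp only [Pi.single_eq_same, map_one, one_mul, mul_one] at h00
    have h00' : 0 < c.1 := by
      have h1 : Pi.single (M := fun _ : Fin 2 => ℂ) 0 1 1 = 0 := by simp
      rw [h1, Complex.normSq_zero, mul_zero, add_zero, mul_zero, Complex.zero_re, mul_zero, add_zero] at h00
      exact_mod_cast h00
    have hdet := h.det_pos
    rw [det_hermTwo, Complex.zero_lt_real] at hdet
    exact ⟨h00', by linarith⟩
  · rintro ⟨ha, hz⟩
    refine Matrix.PosDef.of_dotProduct_mulVec_pos (isHermitian_hermTwo c) fun x hx => ?_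
    rw [star_dotProduct_hermTwo_mulVec, Complex.zero_lt_real]
    -- `a·Q = |a·u + z·v|² + (a·b − |z|²)·|v|²`
    have key : c.1 * (c.1 * Complex.normSq (x 0) + c.2.2 * Complex.normSq (x 1) + 2 * (conj (x 0) * c.2.1 * x 1).re)
        = Complex.normSq ((c.1 : ℂ) * x 0 + c.2.1 * x 1) + (c.1 * c.2.2 - Complex.normSq c.2.1) * Complex.normSq (x 1) := by
      simp only [Complex.normSq_apply, Complex.mul_re, Complex.mul_im, Complex.add_re, Complex.add_im, Complex.conj_re,
        Complex.conj_im, Complex.ofReal_re, Complex.ofReal_im]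
      ring
    by_cases hv : x 1 = 0
    · have hu : x 0 ≠ 0 := by
        intro hu
        apply hx
        funext i
        fin_cases i
        · exact hu
        · exact hv
      have : 0 < Complex.normSq (x 0) := Complex.normSq_pos.mpr hu
      rw [hv]
      simp only [Complex.normSq_zero, mul_zero, add_zero, Complex.zero_re]
      positivity
    · have hv' : 0 < Complex.normSq (x 1) := Complex.normSq_pos.mpr hv
      have h1 : 0 ≤ Complex.normSq ((c.1 : ℂ) * x 0 + c.2.1 * x 1) := Complex.normSq_nonneg _
      have h2 : 0 < (c.1 * c.2.2 - Complex.normSq c.2.1) * Complex.normSq (x 1) := mul_pos (by linarith) hv'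
      nlinarith [key, h1, h2]

/-- The positive cone in the chart, spelled out: `{c | (hermTwo c).PosDef} = {c | 0 < a ∧ |z|² < a·b}`. -/
theorem setOf_posDef_hermTwo :
    {c : ℝ × ℂ × ℝ | (hermTwo c).PosDef} = {c | 0 < c.1 ∧ Complex.normSq c.2.1 < c.1 * c.2.2} :=
  Set.ext fun c => posDef_hermTwo_iff c

/-- The positive cone `Herm₂(ℂ)⁺` is a measurable subset of the chart `ℝ × ℂ × ℝ`. -/
theorem measurableSet_posDef_hermTwo : MeasurableSet {c : ℝ × ℂ × ℝ | (hermTwo c).PosDef} := by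
  rw [setOf_posDef_hermTwo, Set.setOf_and]
  refine MeasurableSet.inter (measurableSet_lt measurable_const measurable_fst) ?_
  exact measurableSet_lt (Complex.continuous_normSq.measurable.comp measurable_snd.fst)
    (measurable_fst.mul measurable_snd.snd)

/-- The positive cone `Herm₂(ℂ)⁺` is an open subset of the chart `ℝ × ℂ × ℝ`. -/
theorem isOpen_setOf_posDef_hermTwo : IsOpen {c : ℝ × ℂ × ℝ | (hermTwo c).PosDef} := by
  rw [setOf_posDef_hermTwo, Set.setOf_and]
  refine IsOpen.inter (isOpen_lt continuous_const continuous_fst) ?_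
  exact isOpen_lt (Complex.continuous_normSq.comp continuous_snd.fst) (continuous_fst.mul continuous_snd.snd)

end Summit.HodgeConjecture.HodgeConjecture.Cruxes.HLiu418.K2LiuHermTwoGammaDefs

end
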